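import Literature.MathematicalPhysics.QuantumFieldTheory.Balaban1983to89.BalabanLocalisedClass
import Literature.MathematicalPhysics.QuantumFieldTheory.Balaban1983to89.B15SU2ChartHolomorphic
import Literature.MathematicalPhysics.QuantumFieldTheory.Balaban1983to89.T4CubeChartExp
import Literature.Analysis.Calculus.ExpDuhamel
import HarnessLib

/-!
# Route `UnitScaleTilt`, crux stmt-QuantumFields-20520 `FluctuationComparisonRegPrIntL`, PATH-B organ ∕ (C2) road (POLYᵘ-H, ✓p826594) —
# **TUBE-ANALYTIC ⟹ (β)-SLICE-ANALYTIC**: an activity holomorphic on Bałaban's complex TUBE around a real `SU(2)` configuration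
# ([Balaban1987RG1] (1.11)–(1.18) p.262–263, the currency of `BalabanLocalisedClass.LocWitness.actC_analytic`) restricts, along the
# complexified two-bond exponential slice, to the organ's (β) letter «`∃ g : ℂ × ℂ → ℂ` holomorphic on a bidisc, reproducing the activity on
# the real two-bond moves `U ↦ U·expPt(s•w)@b·expPt(t•w′)@b′`, with oscillation `≤ wt`» (the `act X` clause of POLYᵘ-H ∕ the frame's (β)).

Cell `ym3-torus`, WIDTH COPY «width 19» of ★p1 (seat `ym3-torus-px19`, gen 23); `--supports stmt-QuantumFields-20520 --as helper`; count-neutral;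
def-free.  UV3-NODE §88 (this seat) G-P6 (ii)∕(iii): the bridge between the tree's two analyticity currencies — print's TUBE and the organ's
two-bond SLICES (§74 (P1)) — so that a tube-currency seed∕conclusion («POLY-seed v0.2») yields the slice-currency letters by restriction, and
with ✓p826141 `block_of_polymerAnalytic` the real `HClauseSq` block.

INHABITATION (★★OWNER RULING №100): LAW-FREE — `actC` is the complex extension `LocWitness.actC X` of one run's activity at the height
(own analyticity on `cplxTube δanU U`, [Balaban1987RG1] (1.18)), or the difference of the two runs' extensions; no fibre law, no score,
no cross-law object.

THE PRINT.  [Balaban1987RG1] p.262 (1.11)–(1.13): the complex space `U^c_j(X, α₀, α₁)` of configurations `𝐔 = U′U`, `U′ = exp iξ𝐀′`,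
`|𝐀′| < α₁`; p.263: «We assume that the function E^{(j)}(X, g_{j−1}, 𝐔, 𝐉) is defined and analytic on the space U^c_j(X, α₀, α₁) … |E^{(j)}(X,
g_{j−1}, 𝐔, 𝐉)| ≤ E₀ exp(−κd_j(X)) (1.18) … for all configurations (𝐔, 𝐉) ∈ U^c_j(X, α₀, α₁)»; [Balaban1985UV3] p.263 (c) «the analyticity with
respect to U₁»; [Balaban1989LargeFieldII] (1.19) p.360 «V′ = exp ig_kB» with `B ∈ 𝔤ᶜ` (the complexified chart, lit ✓`B15SU2ChartHolomorphic.expPointC`).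

WHAT THIS FILE PROVES (sorry-free, def-free; `M₂(ℂ)` with the L²-operator norm = the complex model `BalabanUVClass.CplxModel.specialUnitary (Fin 2)`).
* §1 (complexified direction `ŵ := (a ↦ (w a : ℂ)) ∈ ℂ³`) `norm_genE` (`‖E_a‖ = 1`, lit ✓`norm_quatMatrix`∕`norm_imQuat`),
  `norm_sum_smul_genE_le` (`‖Σ_a z_a E_a‖ ≤ Σ_a ‖z_a‖`), `sum_norm_smul_cvec_le` (`≤ 3‖z‖` for a sup-unit `w`); ★`norm_expPointC_smul_sub_one_le`
  (`‖expPointC (z • ŵ) − 1‖ ≤ e^{3‖z‖} − 1`, lit ✓`Literature.Analysis.Calculus.norm_exp_sub_one_le`); ★`coe_expPt_smul` (`↑(expPt (s • w)) =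
  expPointC (↑s • ŵ)` on REAL parameters, lit ★★`coe_expPoint_eq_expPointC`); `differentiable_expPointC_smul` (lit ★★`differentiable_expPointC`).
* §2 generic bookkeeping for ONE right-multiplicative bond update `F ↦ update F b (F b · E)`: `differentiable_update_mul` (entire in the
  parameters if `F`, `E` are) and `norm_update_mul_sub_le` (distance to the base: `(1 + A)(1 + A′) − 1`).
* §3 ★★★`sliceAnalytic_of_tubeAnalytic` — THE DOOR: `DifferentiableOn ℂ actC (cplxTube δ U)` + agreement with the real `act` on embedded
  real configurations in the tube + oscillation `≤ wt` on the tube + `e^{6r} ≤ 1 + δ` ⟹ for all bond pairs and sup-unit directions, the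
  (β)∕POLYᵘ-H slice letter VERBATIM in shape at radius `r` (instantiate `r := r′·(θ_j∕4)`).  The witness `g z := actC (Φ z)` uses the
  proof-local COMPLEX TWO-BOND SLICE `Φ z = update (update (ι∘U) b (ι(U_b)·expPointC(z.1•ŵ))) b′ (…·expPointC(z.2•ŵ′))`: entire (§2),
  maps the bidisc of radius `r` into the tube (§1–§2), equals `ι∘U` at `0` and the embedded real two-bond move `ι∘Z` at real `(s, t)` (§1).
  ★`sliceAnalytic_of_analyticOnNhd`: the `AnalyticOnNhd` spelling (the hypothesis shape of `LocWitness.actC_analytic`); ★★`sliceAnalytic_family`: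
  the FAMILY corollary in POLYᵘ-H's fourth-conjunct shape (polymers `X : ι`, any window predicate `good`, radius `ρ`; LEAD w3 g28 №11 docking request).

HONEST SCOPE.  Elementary several-complex-variables bookkeeping (composition of a holomorphic map with an entire curve); no estimate of print;
`LocWitness` is inhabited for no run; POLYᵘ-H ∕ O1ᵘ-H are HYPOTHESES; rows v0.1–v0.4 UNDISCHARGED; the five registered stubs, 20520, 19936, 19200,
`YM3TorusSU2` NOT proved; no summit is proved by a helper.  R3 = SU(2) YM₃ on T³ — NOT d = 4, NOT infinite volume, NOT a mass gap, NOT Clay;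
the Yang–Mills mass gap is NOT proved.

References: T. Bałaban, CMP **109** (1987) 249–301 [Balaban1987RG1] ((1.11)–(1.18) pp.262–263); CMP **102** (1985) 255–275 [Balaban1985UV3]
(p.263 (c)); CMP **122** (1989) 355–392 [Balaban1989LargeFieldII] ((1.19) p.360).
-/

noncomputable section

open Function Metric Set
open NormedSpace (exp)
open scoped Matrix.Norms.L2Operator
open Literature.MathematicalPhysics.QuantumFieldTheory.Balaban1983to89
open Literature.MathematicalPhysics.QuantumLattice (fundamentalRep_apply)
open T4CubeChartExp (expPt toE)
open T4HaarSU2ExpChart (imQuat norm_imQuat expPoint)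
open T4QuatExpLog (norm_quatMatrix)
open B15SU2ChartHolomorphic (genE expPointC coe_expPoint_eq_expPointC differentiable_expPointC)
open BalabanUVClass (CplxModel)

namespace Summit.QuantumFields.YangMills.Theorems.OrganTangentSliceOfTubeAnalytic

variable {P : Params} {j : ℕ} [DecidableEq (PBond P j)]

/-! ## §1 The complex direction, the generator norm, the chart on a complex multiple of a sup-unit direction -/

/-- `‖E_a‖ = 1` in the L²-operator norm (`E_a = quatMatrix (ι e_a)`, an isometric image of a unit quaternion).
[cite: Balaban1989LargeFieldII, (1.19) p.360 (bookkeeping)] -/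
theorem norm_genE (a : Fin 3) : ‖genE a‖ = 1 := by
  rw [genE, norm_quatMatrix, norm_imQuat]
  simp

/-- `‖Σ_a z_a • E_a‖ ≤ Σ_a ‖z_a‖`. [cite: Balaban1989LargeFieldII, (1.19) p.360 (bookkeeping)] -/
theorem norm_sum_smul_genE_le (z : EuclideanSpace ℂ (Fin 3)) :
    ‖∑ a : Fin 3, z a • genE a‖ ≤ ∑ a : Fin 3, ‖z a‖ := by
  refine (norm_sum_le _ _).trans (Finset.sum_le_sum fun a _ => ?_)
  rw [norm_smul, norm_genE, mul_one]

/-- For a sup-unit real direction `w` and `z ∈ ℂ`: `Σ_a ‖(z • ŵ)_a‖ ≤ 3‖z‖`. [cite: Balaban1989LargeFieldII, (1.19) p.360 (bookkeeping)] -/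
theorem sum_norm_smul_cvec_le (z : ℂ) {w : Fin 3 → ℝ} (hw : ‖w‖ ≤ 1) :
    ∑ a : Fin 3, ‖(z • (WithLp.toLp 2 (fun a => ((w a : ℝ) : ℂ)) : EuclideanSpace ℂ (Fin 3))) a‖ ≤ 3 * ‖z‖ := by
  have hwa : ∀ a, ‖((w a : ℝ) : ℂ)‖ ≤ 1 := fun a => by
    rw [Complex.norm_real]
    exact (norm_le_pi_norm w a).trans hw
  calc ∑ a : Fin 3, ‖(z • (WithLp.toLp 2 (fun a => ((w a : ℝ) : ℂ)) : EuclideanSpace ℂ (Fin 3))) a‖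
      = ∑ a : Fin 3, ‖z‖ * ‖((w a : ℝ) : ℂ)‖ := by
        refine Finset.sum_congr rfl fun a _ => ?_
        rw [PiLp.smul_apply, PiLp.toLp_apply, smul_eq_mul, norm_mul]
    _ ≤ ∑ _a : Fin 3, ‖z‖ * 1 := Finset.sum_le_sum fun a _ => by gcongr; exact hwa a
    _ = 3 * ‖z‖ := by simp

/-- ★ `‖expPointC (z • ŵ) − 1‖ ≤ e^{3‖z‖} − 1` for a sup-unit direction `w` (lit ✓`norm_exp_sub_one_le`).
[cite: Balaban1987RG1, (1.13) p.262] -/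
theorem norm_expPointC_smul_sub_one_le (z : ℂ) {w : Fin 3 → ℝ} (hw : ‖w‖ ≤ 1) :
    ‖expPointC (z • (WithLp.toLp 2 (fun a => ((w a : ℝ) : ℂ)))) - 1‖ ≤ Real.exp (3 * ‖z‖) - 1 := by
  rw [expPointC]
  refine (Literature.Analysis.Calculus.norm_exp_sub_one_le _).trans ?_
  gcongr
  exact (norm_sum_smul_genE_le _).trans (sum_norm_smul_cvec_le z hw)

/-- ★ On a REAL parameter the chart of record is the complexified chart: `↑(expPt (s • w)) = expPointC (↑s • ŵ)`
(lit ★★`coe_expPoint_eq_expPointC`). [cite: Balaban1989LargeFieldII, (1.19) p.360] -/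
theorem coe_expPt_smul (s : ℝ) (w : Fin 3 → ℝ) :
    ((expPt (s • w) : Matrix.specialUnitaryGroup (Fin 2) ℂ) : Matrix (Fin 2) (Fin 2) ℂ)
      = expPointC ((s : ℂ) • (WithLp.toLp 2 (fun a => ((w a : ℝ) : ℂ)))) := by
  rw [expPt, coe_expPoint_eq_expPointC]
  congr 1
  ext a
  rw [PiLp.smul_apply, PiLp.toLp_apply, smul_eq_mul]
  show (((toE (s • w)) a : ℝ) : ℂ) = _
  rw [show (toE (s • w)) a = s * w a from rfl, Complex.ofReal_mul]

/-- `z ↦ expPointC ((π z) • c)` is entire for any continuous linear `π : ℂ × ℂ → ℂ` (here `π = fst, snd`) — lit ★★`differentiable_expPointC`.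
[cite: Balaban1985Variational, Prop. 9 p.309] -/
theorem differentiable_expPointC_smul (π : ℂ × ℂ →L[ℂ] ℂ) (c : EuclideanSpace ℂ (Fin 3)) :
    Differentiable ℂ (fun z : ℂ × ℂ => expPointC ((π z) • c)) :=
  differentiable_expPointC.comp (π.differentiable.smul_const c)

/-! ## §2 Generic bookkeeping for one right-multiplicative bond update (differentiability, distance to the base, real points) -/

section Update

variable {ι : Type*} [DecidableEq ι]

/-- Updating one coordinate of a differentiable family by right multiplication with a differentiable factor is differentiable.
[cite: Balaban1987RG1, (1.11)-(1.13) p.262 (bookkeeping)] -/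
theorem differentiable_update_mul {F : ℂ × ℂ → ι → Matrix (Fin 2) (Fin 2) ℂ} (hF : Differentiable ℂ F)
    {φ : ℂ × ℂ → Matrix (Fin 2) (Fin 2) ℂ} (hφ : Differentiable ℂ φ) (b : ι) :
    Differentiable ℂ (fun z => update (F z) b (F z b * φ z)) := by
  refine differentiable_pi.mpr fun e => ?_
  by_cases h : e = b
  · subst h
    simp only [update_self]
    exact (differentiable_pi.mp hF e).mul hφ
  · simp only [update_of_ne h]
    exact differentiable_pi.mp hF e

/-- DISTANCE TO THE BASE after one right-multiplicative update: if every `F e` is within `A` of `f₀ e` with `‖f₀ e‖ ≤ 1`, and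
`‖E − 1‖ ≤ A′`, then every coordinate of `update F b (F b * E)` is within `(1 + A)(1 + A′) − 1` of `f₀`.
[cite: Balaban1987RG1, (1.11)-(1.13) p.262 (bookkeeping)] -/
theorem norm_update_mul_sub_le {F f₀ : ι → Matrix (Fin 2) (Fin 2) ℂ} {A A' : ℝ} (hA : 0 ≤ A) (hA' : 0 ≤ A')
    (hf₀ : ∀ e, ‖f₀ e‖ ≤ 1) (hF : ∀ e, ‖F e - f₀ e‖ ≤ A) {E : Matrix (Fin 2) (Fin 2) ℂ} (hE : ‖E - 1‖ ≤ A') (b e : ι) :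
    ‖update F b (F b * E) e - f₀ e‖ ≤ (1 + A) * (1 + A') - 1 := by
  by_cases h : e = b
  · subst h
    rw [update_self]
    have hFb : ‖F e‖ ≤ 1 + A := by
      calc ‖F e‖ = ‖f₀ e + (F e - f₀ e)‖ := by rw [add_sub_cancel]
        _ ≤ ‖f₀ e‖ + ‖F e - f₀ e‖ := norm_add_le _ _
        _ ≤ 1 + A := add_le_add (hf₀ e) (hF e)
    calc ‖F e * E - f₀ e‖ = ‖F e * (E - 1) + (F e - f₀ e)‖ := by rw [mul_sub, mul_one, sub_add_sub_cancel]
      _ ≤ ‖F e * (E - 1)‖ + ‖F e - f₀ e‖ := norm_add_le _ _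
      _ ≤ ‖F e‖ * ‖E - 1‖ + A := add_le_add (norm_mul_le _ _) (hF e)
      _ ≤ (1 + A) * A' + A := by gcongr
      _ = (1 + A) * (1 + A') - 1 := by ring
  · rw [update_of_ne h]
    calc ‖F e - f₀ e‖ ≤ A := hF e
      _ ≤ (1 + A) * (1 + A') - 1 := by nlinarith

end Update

/-! ## §3 The door: tube-analytic ⟹ (β)-slice-analytic -/

/-- ★★★ **TUBE-ANALYTIC ⟹ (β)-SLICE-ANALYTIC.**  Let `U` be a real `SU(2)` configuration, `δ, r, wt` reals with `e^{6r} ≤ 1 + δ`, and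
`actC` a complex activity DIFFERENTIABLE on the complex tube `cplxTube δ U` of the model `SU(2) ⊂ M₂(ℂ)` ([Balaban1987RG1] (1.11)–(1.18):
«analytic on the space U^c_j(X, α₀, α₁)»), agreeing with the real activity `act` at every embedded real configuration in the tube, with
oscillation `‖actC W − actC (ι∘U)‖ ≤ wt` on the tube.  THEN for every bond pair `(b, b′)` and sup-unit directions `w, w′` the organ's (β) ∕
POLYᵘ-H slice letter holds at radius `r`: a holomorphic `g` on the bidisc reproducing `act` on the real two-bond moves, oscillation `≤ wt`.
(Witness: `g z = actC` of the complexified two-bond slice built with lit ✓`expPointC`.) [cite: Balaban1987RG1, (1.18) p.263; Balaban1985UV3, p.263 (c)] -/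
theorem sliceAnalytic_of_tubeAnalytic (U : GaugeField P j (Matrix.specialUnitaryGroup (Fin 2) ℂ)) {δ r wt : ℝ}
    (hr : Real.exp (6 * r) ≤ 1 + δ)
    (actC : (PBond P j → Matrix (Fin 2) (Fin 2) ℂ) → ℂ) (act : GaugeField P j (Matrix.specialUnitaryGroup (Fin 2) ℂ) → ℝ)
    (hA : DifferentiableOn ℂ actC ((CplxModel.specialUnitary (Fin 2)).cplxTube δ U))
    (hagree : ∀ V : GaugeField P j (Matrix.specialUnitaryGroup (Fin 2) ℂ),
      (CplxModel.specialUnitary (Fin 2)).embed V ∈ (CplxModel.specialUnitary (Fin 2)).cplxTube δ U →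
        actC ((CplxModel.specialUnitary (Fin 2)).embed V) = ((act V : ℝ) : ℂ))
    (hosc : ∀ W ∈ (CplxModel.specialUnitary (Fin 2)).cplxTube δ U,
      ‖actC W - actC ((CplxModel.specialUnitary (Fin 2)).embed U)‖ ≤ wt)
    (b b' : PBond P j) (w w' : Fin 3 → ℝ) (hw : ‖w‖ ≤ 1) (hw' : ‖w'‖ ≤ 1) :
    ∃ g : ℂ × ℂ → ℂ, DifferentiableOn ℂ g (ball (0 : ℂ) r ×ˢ ball (0 : ℂ) r) ∧
      (∀ (s t : ℝ) (V Z : GaugeField P j (Matrix.specialUnitaryGroup (Fin 2) ℂ)), |s| < r → |t| < r →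
        (∀ e, e ≠ b → V e = U e) → V b = U b * expPt (s • w) → (∀ e, e ≠ b' → Z e = V e) → Z b' = V b' * expPt (t • w') →
        g ((s : ℂ), (t : ℂ)) = ((act Z : ℝ) : ℂ)) ∧
      ∀ z ∈ ball (0 : ℂ) r ×ˢ ball (0 : ℂ) r, ‖g z - g 0‖ ≤ wt := by
  -- abbreviations (proof-local)
  set M := CplxModel.specialUnitary (Fin 2) with hM
  set cw : EuclideanSpace ℂ (Fin 3) := WithLp.toLp 2 (fun a => ((w a : ℝ) : ℂ)) with hcw
  set cw' : EuclideanSpace ℂ (Fin 3) := WithLp.toLp 2 (fun a => ((w' a : ℝ) : ℂ)) with hcw'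
  set f₀ : PBond P j → Matrix (Fin 2) (Fin 2) ℂ := fun e => ((U e : Matrix.specialUnitaryGroup (Fin 2) ℂ) : Matrix (Fin 2) (Fin 2) ℂ)
    with hf₀
  have hembU : M.embed U = f₀ := by funext e; rfl
  -- the complex slice
  set W₁ : ℂ × ℂ → PBond P j → Matrix (Fin 2) (Fin 2) ℂ := fun z => update f₀ b (f₀ b * expPointC (z.1 • cw)) with hW₁
  set Φ : ℂ × ℂ → PBond P j → Matrix (Fin 2) (Fin 2) ℂ := fun z => update (W₁ z) b' (W₁ z b' * expPointC (z.2 • cw')) with hΦ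
  -- (1) Φ is entire
  have hW₁d : Differentiable ℂ W₁ :=
    differentiable_update_mul (differentiable_const _) (differentiable_expPointC_smul (ContinuousLinearMap.fst ℂ ℂ ℂ) cw) b
  have hΦd : Differentiable ℂ Φ :=
    differentiable_update_mul hW₁d (differentiable_expPointC_smul (ContinuousLinearMap.snd ℂ ℂ ℂ) cw') b'
  -- (2) Φ maps the bidisc into the tube
  have hf₀1 : ∀ e, ‖f₀ e‖ ≤ 1 := fun e => M.norm_le_one (U e)
  have hmaps : MapsTo Φ (ball (0 : ℂ) r ×ˢ ball (0 : ℂ) r) (M.cplxTube δ U) := by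
    intro z hz
    rw [mem_prod, mem_ball_zero_iff, mem_ball_zero_iff] at hz
    have hr0 : 0 < r := (norm_nonneg _).trans_lt hz.1
    have h1 : ‖expPointC (z.1 • cw) - 1‖ ≤ Real.exp (3 * r) - 1 :=
      (norm_expPointC_smul_sub_one_le z.1 hw).trans (by gcongr; exact hz.1.le)
    have h2 : ‖expPointC (z.2 • cw') - 1‖ < Real.exp (3 * r) - 1 :=
      (norm_expPointC_smul_sub_one_le z.2 hw').trans_lt (by gcongr; exact hz.2)
    have hA0 : 0 ≤ Real.exp (3 * r) - 1 := by linarith [Real.add_one_le_exp (3 * r)]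
    have hW₁A : ∀ e, ‖W₁ z e - f₀ e‖ ≤ Real.exp (3 * r) - 1 := fun e => by
      have := norm_update_mul_sub_le (F := f₀) (f₀ := f₀) le_rfl hA0 hf₀1 (fun e => by simp) h1 b e
      simpa using this
    intro e
    show ‖Φ z e - M.ι (U e)‖ < δ
    have hιe : M.ι (U e) = f₀ e := rfl
    rw [hιe]
    -- strictness: enlarge A′ slightly? no — use the strict bound on the second factor through a case split
    by_cases he : e = b'
    · subst he
      have hFb : ‖W₁ z e‖ ≤ 1 + (Real.exp (3 * r) - 1) := by
        calc ‖W₁ z e‖ = ‖f₀ e + (W₁ z e - f₀ e)‖ := by rw [add_sub_cancel]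
          _ ≤ ‖f₀ e‖ + ‖W₁ z e - f₀ e‖ := norm_add_le _ _
          _ ≤ 1 + (Real.exp (3 * r) - 1) := add_le_add (hf₀1 e) (hW₁A e)
      have hpos : 0 < 1 + (Real.exp (3 * r) - 1) := by linarith
      calc ‖Φ z e - f₀ e‖ = ‖W₁ z e * expPointC (z.2 • cw') - f₀ e‖ := by simp [hΦ]
        _ = ‖W₁ z e * (expPointC (z.2 • cw') - 1) + (W₁ z e - f₀ e)‖ := by rw [mul_sub, mul_one, sub_add_sub_cancel]
        _ ≤ ‖W₁ z e‖ * ‖expPointC (z.2 • cw') - 1‖ + ‖W₁ z e - f₀ e‖ :=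
            (norm_add_le _ _).trans (add_le_add (norm_mul_le _ _) le_rfl)
        _ < (1 + (Real.exp (3 * r) - 1)) * (Real.exp (3 * r) - 1) + (Real.exp (3 * r) - 1) := by
            apply add_lt_add_of_lt_of_le _ (hW₁A e)
            calc ‖W₁ z e‖ * ‖expPointC (z.2 • cw') - 1‖ ≤ (1 + (Real.exp (3 * r) - 1)) * ‖expPointC (z.2 • cw') - 1‖ := by
                  gcongr
              _ < (1 + (Real.exp (3 * r) - 1)) * (Real.exp (3 * r) - 1) := by gcongr
        _ = Real.exp (3 * r) * Real.exp (3 * r) - 1 := by ring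
        _ = Real.exp (6 * r) - 1 := by rw [← Real.exp_add]; ring_nf
        _ ≤ δ := by linarith
    · have hΦe : Φ z e = W₁ z e := by simp [hΦ, update_of_ne he]
      rw [hΦe]
      by_cases heb : e = b
      · subst heb
        have h1' : ‖expPointC (z.1 • cw) - 1‖ < Real.exp (3 * r) - 1 :=
          (norm_expPointC_smul_sub_one_le z.1 hw).trans_lt (by gcongr; exact hz.1)
        calc ‖W₁ z e - f₀ e‖ = ‖f₀ e * (expPointC (z.1 • cw) - 1)‖ := by simp [hW₁, mul_sub]
          _ ≤ ‖f₀ e‖ * ‖expPointC (z.1 • cw) - 1‖ := norm_mul_le _ _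
          _ < 1 * (Real.exp (3 * r) - 1) := by
              calc ‖f₀ e‖ * ‖expPointC (z.1 • cw) - 1‖ ≤ 1 * ‖expPointC (z.1 • cw) - 1‖ := by gcongr; exact hf₀1 e
                _ < 1 * (Real.exp (3 * r) - 1) := by gcongr
          _ ≤ Real.exp (6 * r) - 1 := by
              rw [one_mul]; gcongr; linarith
          _ ≤ δ := by linarith
      · have : W₁ z e = f₀ e := by simp [hW₁, update_of_ne heb]
        rw [this, sub_self, norm_zero]
        have : Real.exp (3 * r) - 1 < Real.exp (6 * r) - 1 := by gcongr; linarith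
        linarith
  -- (3) Φ at 0 is the base, Φ at real parameters is the real two-bond move
  have hexp0 : expPointC 0 = 1 := by rw [expPointC]; simp
  have hΦ0 : Φ 0 = M.embed U := by
    rw [hembU]; funext e
    simp [hΦ, hW₁, hexp0]
  have hΦreal : ∀ (s t : ℝ) (V Z : GaugeField P j (Matrix.specialUnitaryGroup (Fin 2) ℂ)),
      (∀ e, e ≠ b → V e = U e) → V b = U b * expPt (s • w) → (∀ e, e ≠ b' → Z e = V e) → Z b' = V b' * expPt (t • w') →
      Φ ((s : ℂ), (t : ℂ)) = M.embed Z := by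
    intro s t V Z hV hVb hZ hZb
    have hW₁V : W₁ ((s : ℂ), (t : ℂ)) = M.embed V := by
      funext e
      by_cases he : e = b
      · subst he
        simp only [hW₁, update_self]
        show f₀ e * expPointC ((s : ℂ) • cw) = M.ι (V e)
        rw [hVb, map_mul]
        show f₀ e * expPointC ((s : ℂ) • cw) = M.ι (U e) * ((expPt (s • w) : Matrix.specialUnitaryGroup (Fin 2) ℂ) : Matrix (Fin 2) (Fin 2) ℂ)
        rw [coe_expPt_smul]; rfl
      · simp only [hW₁, update_of_ne he]
        show f₀ e = M.ι (V e)
        rw [hV e he]; rfl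
    funext e
    by_cases he : e = b'
    · subst he
      simp only [hΦ, update_self]
      rw [hW₁V]
      show M.ι (V e) * expPointC ((t : ℂ) • cw') = M.ι (Z e)
      rw [hZb, map_mul]
      show M.ι (V e) * expPointC ((t : ℂ) • cw') = M.ι (V e) * ((expPt (t • w') : Matrix.specialUnitaryGroup (Fin 2) ℂ) : Matrix (Fin 2) (Fin 2) ℂ)
      rw [coe_expPt_smul]
    · simp only [hΦ, update_of_ne he]
      rw [hW₁V]
      show M.ι (V e) = M.ι (Z e)
      rw [hZ e he]
  -- (4) assemble
  refine ⟨fun z => actC (Φ z), hA.comp hΦd.differentiableOn hmaps, ?_, ?_⟩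
  · intro s t V Z hs ht hV hVb hZ hZb
    have hmem : M.embed Z ∈ M.cplxTube δ U := by
      rw [← hΦreal s t V Z hV hVb hZ hZb]
      apply hmaps
      rw [mem_prod, mem_ball_zero_iff, mem_ball_zero_iff, Complex.norm_real, Complex.norm_real]
      exact ⟨hs, ht⟩
    show actC (Φ ((s : ℂ), (t : ℂ))) = _
    rw [hΦreal s t V Z hV hVb hZ hZb]
    exact hagree Z hmem
  · intro z hz
    show ‖actC (Φ z) - actC (Φ 0)‖ ≤ wt
    rw [hΦ0]
    exact hosc _ (hmaps hz)

/-- ★ THE `AnalyticOnNhd` SPELLING (the hypothesis shape of `BalabanLocalisedClass.LocWitness.actC_analytic`): an activity ANALYTIC on the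
tube restricts to the (β) slice letter. [cite: Balaban1987RG1, (1.18) p.263] -/
theorem sliceAnalytic_of_analyticOnNhd (U : GaugeField P j (Matrix.specialUnitaryGroup (Fin 2) ℂ)) {δ r wt : ℝ}
    (hr : Real.exp (6 * r) ≤ 1 + δ)
    (actC : (PBond P j → Matrix (Fin 2) (Fin 2) ℂ) → ℂ) (act : GaugeField P j (Matrix.specialUnitaryGroup (Fin 2) ℂ) → ℝ)
    (hA : AnalyticOnNhd ℂ actC ((CplxModel.specialUnitary (Fin 2)).cplxTube δ U))
    (hagree : ∀ V : GaugeField P j (Matrix.specialUnitaryGroup (Fin 2) ℂ),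
      (CplxModel.specialUnitary (Fin 2)).embed V ∈ (CplxModel.specialUnitary (Fin 2)).cplxTube δ U →
        actC ((CplxModel.specialUnitary (Fin 2)).embed V) = ((act V : ℝ) : ℂ))
    (hosc : ∀ W ∈ (CplxModel.specialUnitary (Fin 2)).cplxTube δ U,
      ‖actC W - actC ((CplxModel.specialUnitary (Fin 2)).embed U)‖ ≤ wt)
    (b b' : PBond P j) (w w' : Fin 3 → ℝ) (hw : ‖w‖ ≤ 1) (hw' : ‖w'‖ ≤ 1) :
    ∃ g : ℂ × ℂ → ℂ, DifferentiableOn ℂ g (ball (0 : ℂ) r ×ˢ ball (0 : ℂ) r) ∧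
      (∀ (s t : ℝ) (V Z : GaugeField P j (Matrix.specialUnitaryGroup (Fin 2) ℂ)), |s| < r → |t| < r →
        (∀ e, e ≠ b → V e = U e) → V b = U b * expPt (s • w) → (∀ e, e ≠ b' → Z e = V e) → Z b' = V b' * expPt (t • w') →
        g ((s : ℂ), (t : ℂ)) = ((act Z : ℝ) : ℂ)) ∧
      ∀ z ∈ ball (0 : ℂ) r ×ˢ ball (0 : ℂ) r, ‖g z - g 0‖ ≤ wt :=
  sliceAnalytic_of_tubeAnalytic U hr actC act hA.differentiableOn hagree hosc b b' w w' hw hw'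

/-- ★★ **THE FAMILY COROLLARY IN POLYᵘ-H's FOURTH-CONJUNCT SHAPE** (LEAD w3 g28 №11 docking request): for a family of activities
`act X` indexed by polymers `X : ι`, with complex extensions `actC X` differentiable on the tube `cplxTube δ U` around EVERY window
configuration `U` (window = any predicate `good`, e.g. `PlaqSmall (θ_j∕4)`), agreeing with `act X` on embedded real configurations in the
tube and oscillating by `≤ wt X` there, and a radius `ρ` with `e^{6ρ} ≤ 1 + δ` (e.g. `ρ = r·(θ_j∕4)`): the (β)-slice letter of POLYᵘ-H holds
for every `X` and every window `U` — «`∀ X U, good U → ∀ b b′ w₁ w₁′, ‖w₁‖ ≤ 1 → ‖w₁′‖ ≤ 1 → ∃ g, DifferentiableOn ℂ g (ball 0 ρ ×ˢ ball 0 ρ) ∧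
⟨representation along the two real moves⟩ ∧ ∀ z ∈ …, ‖g z − g 0‖ ≤ wt X`». [cite: Balaban1987RG1, (1.18) p.263; Balaban1985UV3, p.263 (c)] -/
theorem sliceAnalytic_family {ι : Type*} {good : GaugeField P j (Matrix.specialUnitaryGroup (Fin 2) ℂ) → Prop} {δ ρ : ℝ}
    (hr : Real.exp (6 * ρ) ≤ 1 + δ)
    (actC : ι → (PBond P j → Matrix (Fin 2) (Fin 2) ℂ) → ℂ) (act : ι → GaugeField P j (Matrix.specialUnitaryGroup (Fin 2) ℂ) → ℝ)
    (wt : ι → ℝ)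
    (hA : ∀ (X : ι) (U : GaugeField P j (Matrix.specialUnitaryGroup (Fin 2) ℂ)), good U →
      DifferentiableOn ℂ (actC X) ((CplxModel.specialUnitary (Fin 2)).cplxTube δ U))
    (hagree : ∀ (X : ι) (U : GaugeField P j (Matrix.specialUnitaryGroup (Fin 2) ℂ)), good U →
      ∀ V : GaugeField P j (Matrix.specialUnitaryGroup (Fin 2) ℂ),
        (CplxModel.specialUnitary (Fin 2)).embed V ∈ (CplxModel.specialUnitary (Fin 2)).cplxTube δ U →
          actC X ((CplxModel.specialUnitary (Fin 2)).embed V) = ((act X V : ℝ) : ℂ))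
    (hosc : ∀ (X : ι) (U : GaugeField P j (Matrix.specialUnitaryGroup (Fin 2) ℂ)), good U →
      ∀ W ∈ (CplxModel.specialUnitary (Fin 2)).cplxTube δ U,
        ‖actC X W - actC X ((CplxModel.specialUnitary (Fin 2)).embed U)‖ ≤ wt X) :
    ∀ (X : ι) (U : GaugeField P j (Matrix.specialUnitaryGroup (Fin 2) ℂ)), good U →
      ∀ (b b' : PBond P j) (w₁ w₁' : Fin 3 → ℝ), ‖w₁‖ ≤ 1 → ‖w₁'‖ ≤ 1 →
        ∃ g : ℂ × ℂ → ℂ, DifferentiableOn ℂ g (ball (0 : ℂ) ρ ×ˢ ball (0 : ℂ) ρ) ∧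
          (∀ (s t : ℝ) (V Z : GaugeField P j (Matrix.specialUnitaryGroup (Fin 2) ℂ)), |s| < ρ → |t| < ρ →
            (∀ e, e ≠ b → V e = U e) → V b = U b * expPt (s • w₁) → (∀ e, e ≠ b' → Z e = V e) → Z b' = V b' * expPt (t • w₁') →
            g ((s : ℂ), (t : ℂ)) = ((act X Z : ℝ) : ℂ)) ∧
          ∀ z ∈ ball (0 : ℂ) ρ ×ˢ ball (0 : ℂ) ρ, ‖g z - g 0‖ ≤ wt X :=
  fun X U hU b b' w₁ w₁' hw hw' =>
    sliceAnalytic_of_tubeAnalytic U hr (actC X) (act X) (hA X U hU) (hagree X U hU) (hosc X U hU) b b' w₁ w₁' hw hw'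

end Summit.QuantumFields.YangMills.Theorems.OrganTangentSliceOfTubeAnalytic
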